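import Literature.Probability.Percolation.KestenZhangPeierls
import HarnessLib

/-!
# Peierls' estimate for `★`-connected sets of blocks MOST of which are bad

Topic `Literature/Probability/Percolation`. The counting step of the renormalisation proof of

* [Pete2008] G. Pete, *A note on percolation on `ℤ^d`: isoperimetric profile via exponential
  cluster repulsion*, Electron. Commun. Probab. **13** (2008) 377–392, §2 (proof of Theorem 1.1:
  "a usual Peierls-argument for the graph `Nℤ^d_*` … gives that if the probability for a block to
  be bad is less than some `ε > 0` …, then the probability of `𝒜_{m,t}` is less than
  `exp(-c₁(N,d) max{m^{1-1/d}, t})`"),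

in the form needed when the `★`-connected set of blocks produced by the geometry is only known to
consist of bad blocks UP TO a controlled number of exceptions (in our rendering of Pete's
Theorem 1.2 / Corollary 1.3 the exceptions are the blocks near the few open boundary edges of the
set `S`; see `SupercriticalIsoperimetricProfileBound.lean`). It extends the tree's
`measureReal_exists_starAnimal_bad_le` (`KestenZhangPeierls.lean`, all blocks bad):

* `measureReal_exists_starAnimal_halfBad_le` — for ANY probability space and any family of events
  `bad : ℤ^d → Set Ω` with the sparse product bound (parameter `δ ∈ [0,1]`, range `r`),
  `μ(⋃ {⋂_{b ∈ Y'} bad b : Y ∋ v ★-connected, #Y = m, Y' ⊆ Y, m ≤ 2 #Y'})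
     ≤ (3^d+1)^{2(m-1)} · 2^m · δ^{⌈m/2⌉ - ((r+1)^d - 1)}`
  (star animals `× ` subsets `×` the one-set bound `measureReal_biInter_bad_le`);
* `measureReal_exists_starAnimal_halfBad_le_ray` — the same for sets meeting a segment of `J + 1`
  blocks (extra factor `J + 1`);
* `halfBad_summand_le_geometric` — domination of the resulting summand by a geometric sequence,
  `(m+1)(3^d+1)^{2(m-1)} 2^m (η²)^{⌈m/2⌉-R} ≤ η^{-2R} (4(3^d+1)² η)^m`.

## References

* G. Pete, Electron. Commun. Probab. 13 (2008) 377–392, §2 [Pete2008].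
* G. Grimmett, *Percolation*, 2nd ed., Springer 1999, §8.6 pp. 222–223 [GrimmettPercolation1999].
-/

noncomputable section

namespace Literature.Probability.Percolation

open MeasureTheory LatticeModels Finset

variable {d : ℕ}

section Peierls

variable {Ω : Type*} [MeasurableSpace Ω] {μ : Measure Ω} [IsFiniteMeasure μ]

/-- **One set of blocks, at least half of them bad**: under the sparse product bound with
parameter `δ ∈ [0, 1]`, for a set `Y` of `m` blocks,
`μ(⋃_{Y' ⊆ Y, m ≤ 2#Y'} ⋂_{b ∈ Y'} bad b) ≤ 2^m δ^{⌈m/2⌉ - ((r+1)^d - 1)}`. [folklore] -/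
theorem measureReal_exists_halfBad_subset_le (bad : Site d → Set Ω) {r : ℕ} {δ : ℝ} (hδ0 : 0 ≤ δ) (hδ1 : δ ≤ 1)
    (hbad : ∀ T : Finset (Site d), (∀ x ∈ T, ∀ y ∈ T, x ≠ y → r < supDist x y) →
      μ.real (⋂ b ∈ T, bad b) ≤ δ ^ ((r + 1) ^ d * T.card))
    {m : ℕ} {Y : Finset (Site d)} (hY : Y.card = m) :
    μ.real (⋃ Y' ∈ Y.powerset.filter (fun Y' => m ≤ 2 * Y'.card), ⋂ b ∈ Y', bad b) ≤
      (2 : ℝ) ^ m * δ ^ ((m + 1) / 2 - ((r + 1) ^ d - 1)) := by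
  have hone : ∀ Y' ∈ Y.powerset.filter (fun Y' => m ≤ 2 * Y'.card),
      μ.real (⋂ b ∈ Y', bad b) ≤ δ ^ ((m + 1) / 2 - ((r + 1) ^ d - 1)) := by
    intro Y' hY'
    have hm : m ≤ 2 * Y'.card := (mem_filter.1 hY').2
    refine (measureReal_biInter_bad_le bad hδ0 hδ1 hbad Y').trans ?_
    exact pow_le_pow_of_le_one hδ0 hδ1 (by omega)
  calc μ.real (⋃ Y' ∈ Y.powerset.filter (fun Y' => m ≤ 2 * Y'.card), ⋂ b ∈ Y', bad b)
      ≤ ∑ Y' ∈ Y.powerset.filter (fun Y' => m ≤ 2 * Y'.card), μ.real (⋂ b ∈ Y', bad b) :=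
        measureReal_biUnion_finset_le _ _
    _ ≤ ∑ _Y' ∈ Y.powerset.filter (fun Y' => m ≤ 2 * Y'.card), δ ^ ((m + 1) / 2 - ((r + 1) ^ d - 1)) :=
        sum_le_sum hone
    _ = (Y.powerset.filter (fun Y' => m ≤ 2 * Y'.card)).card * δ ^ ((m + 1) / 2 - ((r + 1) ^ d - 1)) := by
        rw [sum_const, nsmul_eq_mul]
    _ ≤ (2 : ℝ) ^ m * δ ^ ((m + 1) / 2 - ((r + 1) ^ d - 1)) := by
        refine mul_le_mul_of_nonneg_right ?_ (pow_nonneg hδ0 _)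
        have h1 : (Y.powerset.filter (fun Y' => m ≤ 2 * Y'.card)).card ≤ 2 ^ m := by
          rw [← hY, ← card_powerset]; exact card_filter_le _ _
        exact_mod_cast h1

/-- **Peierls' estimate for `★`-connected sets of blocks at least half of which are bad** (the
"usual Peierls-argument for the graph `Nℤ^d_*`" of Pete 2008, §2, run for a finitely dependent
family through sparse subfamilies as in `measureReal_exists_starAnimal_bad_le`). Let
`bad : ℤ^d → Set Ω` satisfy the sparse product bound `μ(⋂_{b ∈ T} bad b) ≤ δ^{(r+1)^d #T}` for
every finite `T` whose points are pairwise at sup-distance `> r`, where `0 ≤ δ ≤ 1`. Then for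
every block `v` and every `m`,
`μ(⋃ {⋂_{b ∈ Y'} bad b : Y ∈ starAnimals v m, Y' ⊆ Y, m ≤ 2 #Y'})
  ≤ (3^d+1)^{2(m-1)} 2^m δ^{⌈m/2⌉ - ((r+1)^d - 1)}`. [cite: Pete2008, §2 (proof of Theorem 1.1, Peierls argument)] -/
theorem measureReal_exists_starAnimal_halfBad_le (bad : Site d → Set Ω) {r : ℕ} {δ : ℝ} (hδ0 : 0 ≤ δ)
    (hδ1 : δ ≤ 1)
    (hbad : ∀ T : Finset (Site d), (∀ x ∈ T, ∀ y ∈ T, x ≠ y → r < supDist x y) →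
      μ.real (⋂ b ∈ T, bad b) ≤ δ ^ ((r + 1) ^ d * T.card))
    (v : Site d) (m : ℕ) :
    μ.real (⋃ Y ∈ starAnimals v m, ⋃ Y' ∈ Y.powerset.filter (fun Y' => m ≤ 2 * Y'.card), ⋂ b ∈ Y', bad b) ≤
      (3 ^ d + 1 : ℝ) ^ (2 * (m - 1)) * ((2 : ℝ) ^ m * δ ^ ((m + 1) / 2 - ((r + 1) ^ d - 1))) := by
  calc μ.real (⋃ Y ∈ starAnimals v m, ⋃ Y' ∈ Y.powerset.filter (fun Y' => m ≤ 2 * Y'.card), ⋂ b ∈ Y', bad b)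
      ≤ ∑ Y ∈ starAnimals v m, μ.real (⋃ Y' ∈ Y.powerset.filter (fun Y' => m ≤ 2 * Y'.card), ⋂ b ∈ Y', bad b) :=
        measureReal_biUnion_finset_le _ _
    _ ≤ ∑ _Y ∈ starAnimals v m, (2 : ℝ) ^ m * δ ^ ((m + 1) / 2 - ((r + 1) ^ d - 1)) :=
        sum_le_sum fun Y hY => measureReal_exists_halfBad_subset_le bad hδ0 hδ1 hbad (card_of_mem_starAnimals hY)
    _ = (starAnimals v m).card * ((2 : ℝ) ^ m * δ ^ ((m + 1) / 2 - ((r + 1) ^ d - 1))) := by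
        rw [sum_const, nsmul_eq_mul]
    _ ≤ (3 ^ d + 1 : ℝ) ^ (2 * (m - 1)) * ((2 : ℝ) ^ m * δ ^ ((m + 1) / 2 - ((r + 1) ^ d - 1))) := by
        refine mul_le_mul_of_nonneg_right ?_ (by positivity)
        exact_mod_cast card_starAnimals_le v m

/-- **Peierls' estimate for half-bad `★`-connected sets, anchored on a segment**: the same bound,
with an extra factor `J + 1`, for the sets of `m` blocks meeting the segment
`{a + j • e : j ≤ J}`. [cite: Pete2008, §2 (proof of Theorem 1.1, Peierls argument)] -/
theorem measureReal_exists_starAnimal_halfBad_le_ray (bad : Site d → Set Ω) {r : ℕ} {δ : ℝ} (hδ0 : 0 ≤ δ)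
    (hδ1 : δ ≤ 1)
    (hbad : ∀ T : Finset (Site d), (∀ x ∈ T, ∀ y ∈ T, x ≠ y → r < supDist x y) →
      μ.real (⋂ b ∈ T, bad b) ≤ δ ^ ((r + 1) ^ d * T.card))
    (a e : Site d) (J m : ℕ) :
    μ.real (⋃ j ∈ range (J + 1), ⋃ Y ∈ starAnimals (a + (j : ℤ) • e) m,
        ⋃ Y' ∈ Y.powerset.filter (fun Y' => m ≤ 2 * Y'.card), ⋂ b ∈ Y', bad b) ≤
      (J + 1) * ((3 ^ d + 1 : ℝ) ^ (2 * (m - 1)) * ((2 : ℝ) ^ m * δ ^ ((m + 1) / 2 - ((r + 1) ^ d - 1)))) := by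
  calc μ.real (⋃ j ∈ range (J + 1), ⋃ Y ∈ starAnimals (a + (j : ℤ) • e) m,
        ⋃ Y' ∈ Y.powerset.filter (fun Y' => m ≤ 2 * Y'.card), ⋂ b ∈ Y', bad b)
      ≤ ∑ j ∈ range (J + 1), μ.real (⋃ Y ∈ starAnimals (a + (j : ℤ) • e) m,
          ⋃ Y' ∈ Y.powerset.filter (fun Y' => m ≤ 2 * Y'.card), ⋂ b ∈ Y', bad b) :=
        measureReal_biUnion_finset_le _ _
    _ ≤ ∑ _j ∈ range (J + 1), (3 ^ d + 1 : ℝ) ^ (2 * (m - 1)) * ((2 : ℝ) ^ m * δ ^ ((m + 1) / 2 - ((r + 1) ^ d - 1))) :=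
        sum_le_sum fun j _ => measureReal_exists_starAnimal_halfBad_le bad hδ0 hδ1 hbad _ m
    _ = (J + 1) * ((3 ^ d + 1 : ℝ) ^ (2 * (m - 1)) * ((2 : ℝ) ^ m * δ ^ ((m + 1) / 2 - ((r + 1) ^ d - 1)))) := by
        rw [sum_const, card_range, nsmul_eq_mul]
        push_cast
        ring

end Peierls

/-- **Domination of the half-bad summand by a geometric sequence**: with `δ = η²`, `0 < η ≤ 1`,
`ρ = 4(3^d+1)² η`,
`(m+1)(3^d+1)^{2(m-1)} 2^m (η²)^{⌈m/2⌉-R} ≤ (η^{2R})⁻¹ ρ^m`. [folklore] -/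
theorem halfBad_summand_le_geometric (d R : ℕ) {η : ℝ} (hη0 : 0 < η) (hη1 : η ≤ 1) (m : ℕ) :
    (m + 1) * ((3 ^ d + 1 : ℝ) ^ (2 * (m - 1)) * ((2 : ℝ) ^ m * (η ^ 2) ^ ((m + 1) / 2 - R))) ≤
      (η ^ (2 * R))⁻¹ * (4 * (3 ^ d + 1 : ℝ) ^ 2 * η) ^ m := by
  set A : ℝ := (3 ^ d + 1 : ℝ) with hA
  have hA1 : 1 ≤ A := by
    rw [hA]
    have : (0 : ℝ) ≤ 3 ^ d := by positivity
    linarith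
  have h1 : (m + 1 : ℝ) ≤ 2 ^ m := by exact_mod_cast Nat.lt_two_pow_self
  have h2 : A ^ (2 * (m - 1)) ≤ (A ^ 2) ^ m := by
    rw [← pow_mul]; exact pow_le_pow_right₀ hA1 (by omega)
  have h3 : (η ^ 2) ^ ((m + 1) / 2 - R) ≤ (η ^ (2 * R))⁻¹ * η ^ m := by
    rw [le_inv_mul_iff₀ (pow_pos hη0 _), ← pow_mul, ← pow_add]
    exact pow_le_pow_of_le_one hη0.le hη1 (by omega)
  calc (m + 1) * (A ^ (2 * (m - 1)) * ((2 : ℝ) ^ m * (η ^ 2) ^ ((m + 1) / 2 - R)))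
      ≤ 2 ^ m * ((A ^ 2) ^ m * ((2 : ℝ) ^ m * ((η ^ (2 * R))⁻¹ * η ^ m))) := by gcongr
    _ = (η ^ (2 * R))⁻¹ * (4 * A ^ 2 * η) ^ m := by
        rw [mul_pow, mul_pow, show (4 : ℝ) ^ m = 2 ^ m * 2 ^ m by rw [← mul_pow]; norm_num]
        ring

end Literature.Probability.Percolation

end
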